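import Literature.Computability.AlgebraicComplexity.BorderApolarityPerturb
import Literature.Computability.AlgebraicComplexity.TensorApolarityForms
import Literature.Computability.AlgebraicComplexity.WeightInitialSubspace
import HarnessLib

/-!
# Border apolarity without the Borel fixed point theorem, span side: the torus-fixed
# `(110)`-candidate of an approximate decomposition and its `(210)`/`(120)` tests

Topic `Literature/Computability/AlgebraicComplexity`. Companion of `BorderApolarityLimits.lean`,
`BorderApolarityTests.lean` (the IDEAL side: forms vanishing at the points, `I₁₁₀`, `I₂₁₀`, their
limits) and `GradedInitialSubspace.lean`, written for the `⟨2,3,3⟩` lower bound (`BorderRank233*.lean`),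
whose candidates are cheaper to exclude on the SPAN side. For a tensor `t ∈ K^ι ⊗ K^κ ⊗ K^μ` and an
approximate decomposition `∑_{ρ<r} u_ρ(ε) ⊗ v_ρ(ε) ⊗ w_ρ(ε) = ε^h t + O(ε^{h+1})` over `K[ε]`
(`IsApproxDecomposition`; here the FIRST two slots `ι, κ` play the roles of `A, B` of
Conner–Harper–Landsberg 2023 and `μ` the role of `C`), with `L = K(ε)`:

* `testI E = (A ⊗ E) ∩ (S²A ⊗ B)`, `testK E = (E ⊗ B) ∩ (A ⊗ S²B)` — the `(210)`- and
  `(120)`-test spaces of a candidate `E ⊆ A ⊗ B` in coordinates (`symA`/`symB` of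
  `BorderApolarityTests.lean` with `sliceI`/`sliceK`); CHL 2023, §3.
* `exists_candidate_of_isApproxDecomposition` — perturb to general position
  (`pertX`/`pertY`, `BorderApolarityPerturb.lean`), let `W₁, W₂, W₃ ≤ L^{·}` be the `L`-spans of
  the points `u_ρ ⊗ v_ρ`, `u_ρ ⊗ u_ρ ⊗ v_ρ`, `u_ρ ⊗ v_ρ ⊗ v_ρ`, and take limits at `ε = 0`
  (`limSub`, `finrank_limSub_eq`, `BorderApolarityLimits.lean`): `E := lim W₁` has `dim ≤ r`,
  contains every slice `t(·,·,c)` (the lowest coefficient of `∑_ρ w_ρ(c) u_ρ ⊗ v_ρ`), and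
  `lim W₂ ≤ testI E` has `dim = r` (the points `u_ρ ⊗ u_ρ ⊗ v_ρ` are `L`-independent after
  perturbation: the evaluation minor of `BorderApolarityPerturb.lean`); likewise `lim W₃ ≤ testK E`.
  This is the span-side form of CHL 2023, §2.3 (i)–(iii) in bidegrees `(110)`, `(210)`, `(120)`.
* `exists_graded_candidate_of_isApproxDecomposition` — degenerate `E` along a one-parameter torus
  under which the slices of `t` are weight vectors (`WtInit.stage` over `GradedInitialSubspace.lean`):
  dimension, the slices and both test dimensions survive and the result is graded (torus fixed) —
  the torus part of CHL's Borel-fixed normal form (§2.4), with no fixed point theorem.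
* Tools for bounding test dimensions from above: `linearIndependent_of_triangular`,
  `finrank_add_finrank_map_le`, `finrank_slicesI`, `finrank_testI_add` (rank–nullity for the
  skew-symmetrisation `skewIL`).

## References

* A. Conner, A. Harper, J. M. Landsberg, *New lower bounds for matrix multiplication and `det₃`*,
  Forum Math. Pi 11 (2023) e17, arXiv:1911.07981 — §2.3 (i)–(iii), §2.4, §3. [ConnerHarperLandsberg2023]
* W. Buczyńska, J. Buczyński, *Apolarity, border rank, and multigraded Hilbert scheme*, Duke Math.
  J. 170 (2021), arXiv:1910.01944 — Thm. 1.2 (border apolarity). [BuczynskaBuczynski2021]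
-/

noncomputable section

open Polynomial
open scoped Polynomial BigOperators

namespace Literature.Computability.AlgebraicComplexity

namespace BorderApolarity

open TensorApolarity

universe u v

variable {K : Type u} [Field K]
variable {ι κ μ : Type}

/-! ## The test spaces in coordinates -/

/-- The `ι`-slice at `a₀` of a function on `ι × ι × κ`, as a linear map. [folklore] -/
def sliceI (a₀ : ι) : (ι × ι × κ → K) →ₗ[K] (ι × κ → K) where
  toFun y ab := y (a₀, ab.1, ab.2)
  map_add' _ _ := rfl
  map_smul' _ _ := rfl

/-- The `κ`-slice at `b₁` of a function on `ι × κ × κ`, as a linear map. [folklore] -/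
def sliceK (b₁ : κ) : (ι × κ × κ → K) →ₗ[K] (ι × κ → K) where
  toFun z ab := z (ab.1, ab.2, b₁)
  map_add' _ _ := rfl
  map_smul' _ _ := rfl

/-- Entries of `sliceI`. [folklore] -/
@[simp] theorem sliceI_apply (a₀ : ι) (y : ι × ι × κ → K) (ab : ι × κ) :
    sliceI a₀ y ab = y (a₀, ab.1, ab.2) := rfl

/-- Entries of `sliceK`. [folklore] -/
@[simp] theorem sliceK_apply (b₁ : κ) (z : ι × κ × κ → K) (ab : ι × κ) :
    sliceK b₁ z ab = z (ab.1, ab.2, b₁) := rfl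

/-- `A ⊗ E` in coordinates: all `ι`-slices lie in `E`. [cite: ConnerHarperLandsberg2023, §3] -/
def slicesI (E : Submodule K (ι × κ → K)) : Submodule K (ι × ι × κ → K) :=
  ⨅ a₀, E.comap (sliceI a₀)

/-- `E ⊗ B` in coordinates: all `κ`-slices lie in `E`. [cite: ConnerHarperLandsberg2023, §3] -/
def slicesK (E : Submodule K (ι × κ → K)) : Submodule K (ι × κ × κ → K) :=
  ⨅ b₁, E.comap (sliceK b₁)

/-- Membership in `slicesI`. [folklore] -/
theorem mem_slicesI {E : Submodule K (ι × κ → K)} {y : ι × ι × κ → K} :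
    y ∈ slicesI E ↔ ∀ a₀, sliceI a₀ y ∈ E := by
  simp [slicesI, Submodule.mem_iInf]

/-- Membership in `slicesK`. [folklore] -/
theorem mem_slicesK {E : Submodule K (ι × κ → K)} {z : ι × κ × κ → K} :
    z ∈ slicesK E ↔ ∀ b₁, sliceK b₁ z ∈ E := by
  simp [slicesK, Submodule.mem_iInf]

/-- **The `(210)`-test space** `(A ⊗ E) ∩ (S²A ⊗ B)` of a candidate `E ⊆ A ⊗ B`
(`symA` of `BorderApolarityTests.lean`, over `K`). [cite: ConnerHarperLandsberg2023, §3 (the (210) test)] -/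
def testI (E : Submodule K (ι × κ → K)) : Submodule K (ι × ι × κ → K) :=
  symA K (α := ι) (β := κ) ⊓ slicesI E

/-- **The `(120)`-test space** `(E ⊗ B) ∩ (A ⊗ S²B)` of a candidate `E ⊆ A ⊗ B`.
[cite: ConnerHarperLandsberg2023, §3 (the (120) test)] -/
def testK (E : Submodule K (ι × κ → K)) : Submodule K (ι × κ × κ → K) :=
  symB K (α := ι) (β := κ) ⊓ slicesK E

/-- The tests are monotone in the candidate. [folklore] -/
theorem testI_mono {E E' : Submodule K (ι × κ → K)} (h : E ≤ E') : testI E ≤ testI E' :=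
  inf_le_inf_left _ (iInf_mono fun _ => Submodule.comap_mono h)

/-- The tests are monotone in the candidate. [folklore] -/
theorem testK_mono {E E' : Submodule K (ι × κ → K)} (h : E ≤ E') : testK E ≤ testK E' :=
  inf_le_inf_left _ (iInf_mono fun _ => Submodule.comap_mono h)

/-! ## The three `L`-spans of the points of a decomposition (`pt₁`, `pt₂`, `pt₃` of `TensorApolarityForms.lean`) -/

section Points

variable {r : ℕ} (u : Fin r → ι → K[X]) (v : Fin r → κ → K[X])

variable (L : Type v) [Field L] [Algebra K[X] L]

/-- `W₁ = L · {u_ρ ⊗ v_ρ} ≤ L^{A ⊗ B}` (the curve `E₁₁₀(ε)`, over `L = K(ε)`).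
[cite: ConnerHarperLandsberg2023, §2.3] -/
def W₁ : Submodule L (ι × κ → L) := Submodule.span L (Set.range fun ρ => polyVec L (pt₁ u v ρ))

/-- `W₂ = L · {u_ρ ⊗ u_ρ ⊗ v_ρ}` (the curve `E₂₁₀(ε)`). [cite: ConnerHarperLandsberg2023, §2.3] -/
def W₂ : Submodule L (ι × ι × κ → L) := Submodule.span L (Set.range fun ρ => polyVec L (pt₂ u v ρ))

/-- `W₃ = L · {u_ρ ⊗ v_ρ ⊗ v_ρ}` (the curve `E₁₂₀(ε)`). [cite: ConnerHarperLandsberg2023, §2.3] -/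
def W₃ : Submodule L (ι × κ × κ → L) := Submodule.span L (Set.range fun ρ => polyVec L (pt₃ u v ρ))

/-- `W₂` consists of symmetric arrays. [folklore] -/
theorem W₂_le_symA : W₂ u v L ≤ symA L (α := ι) (β := κ) := by
  refine Submodule.span_le.2 ?_
  rintro _ ⟨ρ, rfl⟩ a₀ a b
  simp only [polyVec_apply, pt₂]
  ring_nf

/-- `W₃` consists of symmetric arrays. [folklore] -/
theorem W₃_le_symB : W₃ u v L ≤ symB L (α := ι) (β := κ) := by
  refine Submodule.span_le.2 ?_
  rintro _ ⟨ρ, rfl⟩ a b b₁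
  simp only [polyVec_apply, pt₃]
  ring_nf

/-- `ι`-slices of `W₂` lie in `W₁`. [folklore] -/
theorem map_sliceI_W₂_le (a₀ : ι) : (W₂ u v L).map (sliceI (K := L) a₀) ≤ W₁ u v L := by
  rw [W₂, Submodule.map_span, Submodule.span_le]
  rintro _ ⟨_, ⟨ρ, rfl⟩, rfl⟩
  have : sliceI (K := L) a₀ (polyVec L (pt₂ u v ρ)) =
      algebraMap K[X] L (u ρ a₀) • polyVec L (pt₁ u v ρ) := by
    funext ab
    simp only [sliceI_apply, polyVec_apply, pt₂, pt₁, Pi.smul_apply, smul_eq_mul, map_mul]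
    ring
  rw [this]
  exact Submodule.smul_mem _ _ (Submodule.subset_span ⟨ρ, rfl⟩)

/-- `κ`-slices of `W₃` lie in `W₁`. [folklore] -/
theorem map_sliceK_W₃_le (b₁ : κ) : (W₃ u v L).map (sliceK (K := L) b₁) ≤ W₁ u v L := by
  rw [W₃, Submodule.map_span, Submodule.span_le]
  rintro _ ⟨_, ⟨ρ, rfl⟩, rfl⟩
  have : sliceK (K := L) b₁ (polyVec L (pt₃ u v ρ)) =
      algebraMap K[X] L (v ρ b₁) • polyVec L (pt₁ u v ρ) := by
    funext ab
    simp only [sliceK_apply, polyVec_apply, pt₃, pt₁, Pi.smul_apply, smul_eq_mul, map_mul]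
    ring
  rw [this]
  exact Submodule.smul_mem _ _ (Submodule.subset_span ⟨ρ, rfl⟩)

variable [IsFractionRing K[X] L]

/-- **`lim W₂ ≤ testI (lim W₁)`**: symmetry and the slice relation survive the limit
(span-side form of CHL 2023, §2.3 (iii)). [cite: ConnerHarperLandsberg2023, §2.3 (iii)] -/
theorem limSub_W₂_le : limSub K L (W₂ u v L) ≤ testI (limSub K L (W₁ u v L)) := by
  intro y hy
  obtain ⟨g, hg, rfl⟩ := (mem_limSub_iff (K := K) L).1 hy
  have hgW : polyVec L g ∈ W₂ u v L := hg
  refine ⟨fun a₀ a b => ?_, mem_slicesI.2 fun a₀ => ?_⟩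
  · have h := (mem_symA L).1 (W₂_le_symA u v L hgW) a₀ a b
    simp only [polyVec_apply] at h
    have h' : g (a₀, a, b) = g (a, a₀, b) := IsFractionRing.injective K[X] L h
    simp [h']
  · have hmem : (fun ab : ι × κ => g (a₀, ab.1, ab.2)) ∈ latt K L (W₁ u v L) := by
      rw [mem_latt]
      have : polyVec L (fun ab : ι × κ => g (a₀, ab.1, ab.2)) = sliceI (K := L) a₀ (polyVec L g) :=
        funext fun ab => rfl
      rw [this]
      exact map_sliceI_W₂_le u v L a₀ (Submodule.mem_map_of_mem hgW)
    exact ev0_mem_limSub (K := K) L hmem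

/-- **`lim W₃ ≤ testK (lim W₁)`**. [cite: ConnerHarperLandsberg2023, §2.3 (iii)] -/
theorem limSub_W₃_le : limSub K L (W₃ u v L) ≤ testK (limSub K L (W₁ u v L)) := by
  intro z hz
  obtain ⟨g, hg, rfl⟩ := (mem_limSub_iff (K := K) L).1 hz
  have hgW : polyVec L g ∈ W₃ u v L := hg
  refine ⟨fun a b b₁ => ?_, mem_slicesK.2 fun b₁ => ?_⟩
  · have h := (mem_symB L).1 (W₃_le_symB u v L hgW) a b b₁
    simp only [polyVec_apply] at h
    have h' : g (a, b, b₁) = g (a, b₁, b) := IsFractionRing.injective K[X] L h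
    simp [h']
  · have hmem : (fun ab : ι × κ => g (ab.1, ab.2, b₁)) ∈ latt K L (W₁ u v L) := by
      rw [mem_latt]
      have : polyVec L (fun ab : ι × κ => g (ab.1, ab.2, b₁)) = sliceK (K := L) b₁ (polyVec L g) :=
        funext fun ab => rfl
      rw [this]
      exact map_sliceK_W₃_le u v L b₁ (Submodule.mem_map_of_mem hgW)
    exact ev0_mem_limSub (K := K) L hmem

/-- **`T(C^*) ⊆ lim W₁`**: every slice `t(·,·,c)` of the decomposed tensor lies in the limit (it is
the lowest coefficient of `∑_ρ w_ρ(c) u_ρ ⊗ v_ρ`; span-side form of CHL 2023, §2.3 (i)).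
[cite: ConnerHarperLandsberg2023, §2.3 (i)] -/
theorem slice_mem_limSub_W₁ {h : ℕ} {t : ι → κ → μ → K} {w : Fin r → μ → K[X]}
    (hd : IsApproxDecomposition h t u v w) (c : μ) :
    (fun ab : ι × κ => t ab.1 ab.2 c) ∈ limSub K L (W₁ u v L) := by
  set x : ι × κ → K[X] := fun ab => ∑ ρ, u ρ ab.1 * v ρ ab.2 * w ρ c with hx
  have hlow : ∀ ab : ι × κ, ∀ e < h, (x ab).coeff e = 0 := fun ab e he => by
    rw [hx]; exact (hd ab.1 ab.2 c e he.le).trans (if_neg he.ne)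
  have hdvd : ∀ ab, X ^ h ∣ x ab := fun ab => X_pow_dvd_iff.2 (hlow ab)
  choose g hg using hdvd
  have hxg : x = (X : K[X]) ^ h • g := funext fun ab => by rw [Pi.smul_apply, smul_eq_mul]; exact hg ab
  have hxW : x ∈ latt K L (W₁ u v L) := by
    rw [mem_latt]
    have : polyVec L x = ∑ ρ, algebraMap K[X] L (w ρ c) • polyVec L (pt₁ u v ρ) := by
      funext ab
      simp only [polyVec_apply, hx, map_sum, Finset.sum_apply, Pi.smul_apply, smul_eq_mul, pt₁,
        map_mul]
      exact Finset.sum_congr rfl fun ρ _ => by ring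
    rw [this]
    exact Submodule.sum_mem _ fun ρ _ => Submodule.smul_mem _ _ (Submodule.subset_span ⟨ρ, rfl⟩)
  have hgW : g ∈ latt K L (W₁ u v L) :=
    (smul_mem_latt_iff (K := K) L (pow_ne_zero h X_ne_zero)).1 (hxg ▸ hxW)
  have key := ev0_mem_limSub (K := K) L hgW
  convert key using 1
  funext ab
  have h1 : (x ab).coeff h = (g ab).coeff 0 := by
    rw [hg ab]; simpa using coeff_X_pow_mul (g ab) h 0
  have h2 : (x ab).coeff h = t ab.1 ab.2 c := by
    rw [hx]; exact (hd ab.1 ab.2 c h le_rfl).trans (if_pos rfl)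
  rw [ev0ₗ_apply, ← h1, h2]

variable [Fintype ι] [Fintype κ]

/-- `dim lim W₁ ≤ r`. [cite: ConnerHarperLandsberg2023, §2.3] -/
theorem finrank_limSub_W₁_le : Module.finrank K (limSub K L (W₁ u v L)) ≤ r := by
  rw [finrank_limSub_eq K L]
  exact (finrank_range_le_card _).trans (by simp)

/-- `dim lim W₂ = r` when the points `u_ρ ⊗ u_ρ ⊗ v_ρ` are `L`-independent. [cite: ConnerHarperLandsberg2023, §2.3] -/
theorem finrank_limSub_W₂_eq (hli : LinearIndependent L fun ρ => polyVec L (pt₂ u v ρ)) :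
    Module.finrank K (limSub K L (W₂ u v L)) = r := by
  rw [finrank_limSub_eq K L, W₂, finrank_span_eq_card hli, Fintype.card_fin]

/-- `dim lim W₃ = r` when the points `u_ρ ⊗ v_ρ ⊗ v_ρ` are `L`-independent. [cite: ConnerHarperLandsberg2023, §2.3] -/
theorem finrank_limSub_W₃_eq (hli : LinearIndependent L fun ρ => polyVec L (pt₃ u v ρ)) :
    Module.finrank K (limSub K L (W₃ u v L)) = r := by
  rw [finrank_limSub_eq K L, W₃, finrank_span_eq_card hli, Fintype.card_fin]

end Points

/-! ## General position: the perturbed points are `L`-independent -/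

section GeneralPosition

variable {r : ℕ} [DecidableEq ι] [DecidableEq κ]
variable (L : Type v) [Field L] [Algebra K[X] L] [IsFractionRing K[X] L]

/-- Perturbing the FIRST two slots by `ε^N` (`N > h`) keeps an order-`h` approximate decomposition
(the `(ι, κ)`-slot form of `isApproxDecomposition_pert` of `BorderApolarityPerturb.lean`).
[cite: ConnerHarperLandsberg2023, §2.3 (ii)] -/
theorem isApproxDecomposition_pert₁₂ {h : ℕ} {t : ι → κ → μ → K} {u : Fin r → ι → K[X]}
    {v : Fin r → κ → K[X]} {w : Fin r → μ → K[X]} (hd : IsApproxDecomposition h t u v w)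
    (pa : Fin r → ι) (pb : Fin r → κ) {N : ℕ} (hN : h < N) :
    IsApproxDecomposition h t (pertX u pa N) (pertY v pb N) w := by
  intro a b c j hj
  have hsplit : ∑ ρ, pertX u pa N ρ a * pertY v pb N ρ b * w ρ c =
      ∑ ρ, u ρ a * v ρ b * w ρ c + X ^ N * ∑ ρ, w ρ c *
        (u ρ a * (if b = pb ρ then 1 else 0) + (if a = pa ρ then 1 else 0) * v ρ b +
          X ^ N * ((if a = pa ρ then 1 else 0) * if b = pb ρ then 1 else 0)) := by
    rw [Finset.mul_sum, ← Finset.sum_add_distrib]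
    refine Finset.sum_congr rfl fun ρ _ => ?_
    rw [pertX_apply, pertY_apply]
    ring
  rw [hsplit, coeff_add, coeff_X_pow_mul', if_neg (by omega), add_zero]
  exact hd a b c j hj

/-- **The perturbed points `u_ρ ⊗ u_ρ ⊗ v_ρ` are `L`-independent** (their evaluation minor at the
coordinates `(pa j, pa j, pb j)` is `ε^{3N} · 1 +` lower order, `BorderApolarityPerturb.lean`).
[cite: ConnerHarperLandsberg2023, §2.3 (ii)] -/
theorem linearIndependent_pt₂_pert {u : Fin r → ι → K[X]} {v : Fin r → κ → K[X]}
    {pa : Fin r → ι} {pb : Fin r → κ} {N : ℕ} (hinj : Function.Injective fun ρ => (pa ρ, pb ρ))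
    (hu : ∀ ρ a, (u ρ a).natDegree < N) (hv : ∀ ρ b, (v ρ b).natDegree < N) (hN : 0 < N) :
    LinearIndependent L fun ρ => polyVec L (pt₂ (pertX u pa N) (pertY v pb N) ρ) := by
  set M₀ : Matrix (Fin r) (Fin r) K[X] :=
    Matrix.of fun ρ j => pertX u pa N ρ (pa j) ^ 2 * pertY v pb N ρ (pb j) with hM₀
  have hdet : M₀.det ≠ 0 :=
    det_ne_zero_of_degree_lt (3 * N) M₀ (fun ρ => degree_diag21_lt hu hv hN ρ)
      (fun ρ j hρj => degree_off21_lt hinj hu hv hN hρj)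
  have hdetL : (M₀.map (algebraMap K[X] L)).det ≠ 0 := by
    rw [← RingHom.mapMatrix_apply, ← RingHom.map_det]
    exact (IsFractionRing.injective K[X] L).ne_iff' (map_zero _) |>.2 hdet
  rw [Fintype.linearIndependent_iff]
  intro g hg ρ₀
  have hvec : Matrix.vecMul g (M₀.map (algebraMap K[X] L)) = 0 := by
    funext j
    have hj := congr_fun hg (pa j, pa j, pb j)
    simp only [Finset.sum_apply, Pi.smul_apply, smul_eq_mul, Pi.zero_apply, polyVec_apply,
      pt₂, map_mul] at hj
    simp only [Matrix.vecMul, dotProduct, Matrix.map_apply, Matrix.of_apply, Pi.zero_apply,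
      map_mul, map_pow, hM₀]
    rw [← hj]
    exact Finset.sum_congr rfl fun ρ _ => by ring
  exact congr_fun (Matrix.eq_zero_of_vecMul_eq_zero hdetL hvec) ρ₀

/-- **The perturbed points `u_ρ ⊗ v_ρ ⊗ v_ρ` are `L`-independent.** [cite: ConnerHarperLandsberg2023, §2.3 (ii)] -/
theorem linearIndependent_pt₃_pert {u : Fin r → ι → K[X]} {v : Fin r → κ → K[X]}
    {pa : Fin r → ι} {pb : Fin r → κ} {N : ℕ} (hinj : Function.Injective fun ρ => (pa ρ, pb ρ))
    (hu : ∀ ρ a, (u ρ a).natDegree < N) (hv : ∀ ρ b, (v ρ b).natDegree < N) (hN : 0 < N) :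
    LinearIndependent L fun ρ => polyVec L (pt₃ (pertX u pa N) (pertY v pb N) ρ) := by
  set M₀ : Matrix (Fin r) (Fin r) K[X] :=
    Matrix.of fun ρ j => pertX u pa N ρ (pa j) * pertY v pb N ρ (pb j) ^ 2 with hM₀
  have hdet : M₀.det ≠ 0 :=
    det_ne_zero_of_degree_lt (3 * N) M₀ (fun ρ => degree_diag12_lt hu hv hN ρ)
      (fun ρ j hρj => degree_off12_lt hinj hu hv hN hρj)
  have hdetL : (M₀.map (algebraMap K[X] L)).det ≠ 0 := by
    rw [← RingHom.mapMatrix_apply, ← RingHom.map_det]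
    exact (IsFractionRing.injective K[X] L).ne_iff' (map_zero _) |>.2 hdet
  rw [Fintype.linearIndependent_iff]
  intro g hg ρ₀
  have hvec : Matrix.vecMul g (M₀.map (algebraMap K[X] L)) = 0 := by
    funext j
    have hj := congr_fun hg (pa j, pb j, pb j)
    simp only [Finset.sum_apply, Pi.smul_apply, smul_eq_mul, Pi.zero_apply, polyVec_apply,
      pt₃, map_mul] at hj
    simp only [Matrix.vecMul, dotProduct, Matrix.map_apply, Matrix.of_apply, Pi.zero_apply,
      map_mul, map_pow, hM₀]
    rw [← hj]
    exact Finset.sum_congr rfl fun ρ _ => by ring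
  exact congr_fun (Matrix.eq_zero_of_vecMul_eq_zero hdetL hvec) ρ₀

end GeneralPosition

/-! ## The candidate of a decomposition -/

section Candidate

variable {r : ℕ} [Fintype ι] [Fintype κ] [DecidableEq ι] [DecidableEq κ]

/-- **The `(110)`-candidate of an approximate decomposition (elementary weak border apolarity, span
side).** If `t` has an order-`h` approximate decomposition with `r` triads and `r ≤ |ι × κ|`, there
is a subspace `E ⊆ K^{ι × κ}` with `dim E ≤ r`, containing every slice `t(·,·,c)`, whose `(210)`-
and `(120)`-test spaces have dimension `≥ r`. [cite: ConnerHarperLandsberg2023, §2.3 (i)–(iii) and §3]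
[cite: BuczynskaBuczynski2021, Thm. 1.2] -/
theorem exists_candidate_of_isApproxDecomposition {h : ℕ} {t : ι → κ → μ → K}
    {u : Fin r → ι → K[X]} {v : Fin r → κ → K[X]} {w : Fin r → μ → K[X]}
    (hd : IsApproxDecomposition h t u v w) (pt : Fin r → ι × κ) (hpt : Function.Injective pt) :
    ∃ E : Submodule K (ι × κ → K), Module.finrank K E ≤ r ∧
      (∀ c, (fun ab : ι × κ => t ab.1 ab.2 c) ∈ E) ∧
      r ≤ Module.finrank K (testI E) ∧ r ≤ Module.finrank K (testK E) := by
  -- perturb to general position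
  set N := TensorApolarity.degBound u v + h + 1 with hN
  have hu : ∀ ρ a, (u ρ a).natDegree < N := fun ρ a =>
    lt_of_le_of_lt (TensorApolarity.natDegree_v_le_degBound u v ρ a) (by omega)
  have hv : ∀ ρ b, (v ρ b).natDegree < N := fun ρ b =>
    lt_of_le_of_lt (TensorApolarity.natDegree_w_le_degBound u v ρ b) (by omega)
  set u' := pertX u (fun ρ => (pt ρ).1) N with hu'
  set v' := pertY v (fun ρ => (pt ρ).2) N with hv'
  have hd' : IsApproxDecomposition h t u' v' w := isApproxDecomposition_pert₁₂ hd _ _ (by omega)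
  have hinj : Function.Injective fun ρ => ((pt ρ).1, (pt ρ).2) := by
    intro ρ ρ' hρ; exact hpt (Prod.ext (Prod.mk.inj hρ).1 (Prod.mk.inj hρ).2)
  -- the limits over `L = K(ε)`
  let L := FractionRing K[X]
  refine ⟨limSub K L (W₁ u' v' L), finrank_limSub_W₁_le u' v' L, slice_mem_limSub_W₁ u' v' L hd',
    ?_, ?_⟩
  · calc r = Module.finrank K (limSub K L (W₂ u' v' L)) :=
          (finrank_limSub_W₂_eq u' v' L (linearIndependent_pt₂_pert L hinj hu hv (by omega))).symm
      _ ≤ _ := Submodule.finrank_mono (limSub_W₂_le u' v' L)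
  · calc r = Module.finrank K (limSub K L (W₃ u' v' L)) :=
          (finrank_limSub_W₃_eq u' v' L (linearIndependent_pt₃_pert L hinj hu hv (by omega))).symm
      _ ≤ _ := Submodule.finrank_mono (limSub_W₃_le u' v' L)

end Candidate

/-! ## Torus degeneration of a candidate (integer weights, `GradedInitialSubspace.lean`) -/

section Graded

variable (eA : ι → ℕ) (eB : κ → ℕ)

/-- Integer degree of a `(110)` coordinate: the torus weight `wt₁` of `TensorApolarityForms.lean`
(the degrees of `GradedInitialSubspace.lean` are integers). [folklore] -/
def degIK : ι × κ → ℤ := fun p => (wt₁ eA eB p : ℤ)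

/-- Integer degree of a `(210)` coordinate (`wt₂`). [folklore] -/
def degIIK : ι × ι × κ → ℤ := fun s => (wt₂ eA eB s : ℤ)

/-- Integer degree of a `(120)` coordinate (`wt₃`). [folklore] -/
def degIKK : ι × κ × κ → ℤ := fun s => (wt₃ eA eB s : ℤ)

/-- A weight projection outside the range of the weights is zero. [folklore] -/
theorem projDeg_eq_zero_of_forall_ne {σ : Type} (deg : σ → ℤ) {d : ℤ} (hd : ∀ s, deg s ≠ d)
    (x : σ → K) : projDeg deg d x = 0 :=
  funext fun s => by simp [projDeg, hd s]

/-- A weight projection of a vector of `E ∩ V_{≥ d}` lies in the full stage over a window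
containing all weights. [folklore] -/
theorem projDeg_mem_stage_window {σ : Type} (deg : σ → ℤ) {E : Submodule K (σ → K)} {d₀ : ℤ}
    {n : ℕ} (hlo : ∀ s, d₀ ≤ deg s) (hhi : ∀ s, deg s < d₀ + n) {z : σ → K} (hzE : z ∈ E) (d : ℤ)
    (hzV : z ∈ Vge deg d) : projDeg deg d z ∈ WtInit.stage deg E d₀ n := by
  by_cases hin : d₀ ≤ d ∧ d < d₀ + n
  · obtain ⟨i, hi⟩ : ∃ i : ℕ, d = d₀ + i := ⟨(d - d₀).toNat, by omega⟩
    subst hi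
    exact WtInit.projDeg_mem_stage_of_mem deg E d₀ (by omega) hzE hzV
  · rw [projDeg_eq_zero_of_forall_ne deg (fun s h => hin ?_) z]
    · exact Submodule.zero_mem _
    · have := hlo s; have := hhi s; omega

/-- Slices of a weight projection on `ι × ι × κ` are weight projections of slices. [folklore] -/
theorem sliceI_projDeg (d : ℤ) (y : ι × ι × κ → K) (a₀ : ι) :
    sliceI a₀ (projDeg (degIIK eA eB) d y) = projDeg (degIK eA eB) (d - eA a₀) (sliceI a₀ y) := by
  funext ab
  simp only [sliceI_apply, projDeg, LinearMap.coe_mk, AddHom.coe_mk, degIIK, degIK, wt₂, wt₁]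
  push_cast
  by_cases h : (eA a₀ : ℤ) + eA ab.1 + eB ab.2 = d
  · rw [if_pos h, if_pos (by omega)]
  · rw [if_neg h, if_neg (by omega)]

/-- Slices of a weight projection on `ι × κ × κ` are weight projections of slices. [folklore] -/
theorem sliceK_projDeg (d : ℤ) (z : ι × κ × κ → K) (b₁ : κ) :
    sliceK b₁ (projDeg (degIKK eA eB) d z) = projDeg (degIK eA eB) (d - eB b₁) (sliceK b₁ z) := by
  funext ab
  simp only [sliceK_apply, projDeg, LinearMap.coe_mk, AddHom.coe_mk, degIKK, degIK, wt₃, wt₁]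
  push_cast
  by_cases h : (eA ab.1 : ℤ) + eB ab.2 + eB b₁ = d
  · rw [if_pos h, if_pos (by omega)]
  · rw [if_neg h, if_neg (by omega)]

/-- **The `(210)`-test survives the torus degeneration**: the degeneration of the test space of `E`
lies in the test space of the degeneration of `E`. [cite: ConnerHarperLandsberg2023, §2.4] -/
theorem stage_testI_le (E : Submodule K (ι × κ → K)) {d₀ : ℤ} {n : ℕ}
    (hlo : ∀ ab, d₀ ≤ degIK eA eB ab) (hhi : ∀ ab, degIK eA eB ab < d₀ + n) (e₀ : ℤ) :
    ∀ m, WtInit.stage (degIIK eA eB) (testI E) e₀ m ≤ testI (WtInit.stage (degIK eA eB) E d₀ n) := by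
  intro m
  induction m with
  | zero => exact bot_le
  | succ m ih =>
    rw [WtInit.stage_succ]
    refine sup_le ih ?_
    rintro _ ⟨y, ⟨⟨hys, hyE⟩, hyw⟩, rfl⟩
    refine ⟨fun a₀ a b => ?_, mem_slicesI.2 fun a₀ => ?_⟩
    · change (if degIIK eA eB (a₀, a, b) = e₀ + m then y (a₀, a, b) else 0) =
        if degIIK eA eB (a, a₀, b) = e₀ + m then y (a, a₀, b) else 0
      have hwt : degIIK eA eB (a₀, a, b) = degIIK eA eB (a, a₀, b) := by
        simp only [degIIK, wt₂]; ring
      rw [hwt, hys a₀ a b]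
    · rw [sliceI_projDeg]
      refine projDeg_mem_stage_window _ hlo hhi (mem_slicesI.1 hyE a₀) _ ?_
      refine (mem_Vge _).2 fun ab hab => ?_
      simp only [sliceI_apply]
      exact (mem_Vge _).1 hyw (a₀, ab.1, ab.2) (by
        simp only [degIIK, wt₂]; simp only [degIK, wt₁] at hab; push_cast at hab ⊢; omega)

/-- **The `(120)`-test survives the torus degeneration.** [cite: ConnerHarperLandsberg2023, §2.4] -/
theorem stage_testK_le (E : Submodule K (ι × κ → K)) {d₀ : ℤ} {n : ℕ}
    (hlo : ∀ ab, d₀ ≤ degIK eA eB ab) (hhi : ∀ ab, degIK eA eB ab < d₀ + n) (e₀ : ℤ) :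
    ∀ m, WtInit.stage (degIKK eA eB) (testK E) e₀ m ≤ testK (WtInit.stage (degIK eA eB) E d₀ n) := by
  intro m
  induction m with
  | zero => exact bot_le
  | succ m ih =>
    rw [WtInit.stage_succ]
    refine sup_le ih ?_
    rintro _ ⟨z, ⟨⟨hzs, hzE⟩, hzw⟩, rfl⟩
    refine ⟨fun a b b₁ => ?_, mem_slicesK.2 fun b₁ => ?_⟩
    · change (if degIKK eA eB (a, b, b₁) = e₀ + m then z (a, b, b₁) else 0) =
        if degIKK eA eB (a, b₁, b) = e₀ + m then z (a, b₁, b) else 0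
      have hwt : degIKK eA eB (a, b, b₁) = degIKK eA eB (a, b₁, b) := by
        simp only [degIKK, wt₃]; ring
      rw [hwt, hzs a b b₁]
    · rw [sliceK_projDeg]
      refine projDeg_mem_stage_window _ hlo hhi (mem_slicesK.1 hzE b₁) _ ?_
      refine (mem_Vge _).2 fun ab hab => ?_
      simp only [sliceK_apply]
      exact (mem_Vge _).1 hzw (ab.1, ab.2, b₁) (by
        simp only [degIKK, wt₃]; simp only [degIK, wt₁] at hab; push_cast at hab ⊢; omega)

/-- **The torus-fixed `(110)`-candidate of an approximate decomposition.** Under integer weights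
`eA, eB < W` for which every slice `t(·,·,c)` is a weight vector, an order-`h` approximate
decomposition of `t` with `r ≤ |ι × κ|` triads yields a subspace `E ⊆ K^{ι × κ}` stable under all
weight projections (torus fixed), with `dim E ≤ r`, containing every slice `t(·,·,c)`, and passing
the `(210)`- and `(120)`-tests (`dim ≥ r`) — the torus part of the Borel-fixed normal form of
Conner–Harper–Landsberg, by explicit degeneration instead of the fixed point theorem.
[cite: ConnerHarperLandsberg2023, §2.4 and §3] [cite: BuczynskaBuczynski2021, Thm. 1.2] -/
theorem exists_graded_candidate_of_isApproxDecomposition [Fintype ι] [Fintype κ] [DecidableEq ι]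
    [DecidableEq κ] {r h : ℕ} {t : ι → κ → μ → K}
    {u : Fin r → ι → K[X]} {v : Fin r → κ → K[X]} {w : Fin r → μ → K[X]}
    (hd : IsApproxDecomposition h t u v w) (pt : Fin r → ι × κ) (hpt : Function.Injective pt)
    {W : ℕ} (hWι : ∀ a, eA a < W) (hWκ : ∀ b, eB b < W)
    (ht : ∀ c, ∃ n : ℕ, ∀ a b, t a b c ≠ 0 → eA a + eB b = n) :
    ∃ E : Submodule K (ι × κ → K), Module.finrank K E ≤ r ∧
      (∀ c, (fun ab : ι × κ => t ab.1 ab.2 c) ∈ E) ∧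
      r ≤ Module.finrank K (testI E) ∧ r ≤ Module.finrank K (testK E) ∧
      (∀ d, ∀ x ∈ E, projDeg (degIK eA eB) d x ∈ E) := by
  obtain ⟨E₀, hdim, hsl, hI, hK⟩ := exists_candidate_of_isApproxDecomposition hd pt hpt
  have hlo : ∀ ab, (0 : ℤ) ≤ degIK eA eB ab := fun ab => by simp only [degIK]; omega
  have hhi : ∀ ab, degIK eA eB ab < 0 + ((W + W : ℕ) : ℤ) := fun ab => by
    simp only [degIK, wt₁]; have := hWι ab.1; have := hWκ ab.2; push_cast; omega
  have hlo₂ : ∀ s, (0 : ℤ) ≤ degIIK eA eB s := fun s => by simp only [degIIK]; omega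
  have hhi₂ : ∀ s, degIIK eA eB s < 0 + ((W + W + W : ℕ) : ℤ) := fun s => by
    simp only [degIIK, wt₂]; have := hWι s.1; have := hWι s.2.1; have := hWκ s.2.2; push_cast; omega
  have hlo₃ : ∀ s, (0 : ℤ) ≤ degIKK eA eB s := fun s => by simp only [degIKK]; omega
  have hhi₃ : ∀ s, degIKK eA eB s < 0 + ((W + W + W : ℕ) : ℤ) := fun s => by
    simp only [degIKK, wt₃]; have := hWι s.1; have := hWκ s.2.1; have := hWκ s.2.2; push_cast; omega
  refine ⟨WtInit.stage (degIK eA eB) E₀ 0 (W + W), ?_, fun c => ?_, ?_, ?_, fun d x hx => ?_⟩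
  · rw [WtInit.finrank_stage_eq _ E₀ hlo hhi]
    exact hdim
  · obtain ⟨n, hn⟩ := ht c
    by_cases hz : (fun ab : ι × κ => t ab.1 ab.2 c) = 0
    · rw [hz]
      exact Submodule.zero_mem _
    · have hex : ∃ ab : ι × κ, t ab.1 ab.2 c ≠ 0 := by
        by_contra hall
        push Not at hall
        exact hz (funext fun ab => hall ab)
      obtain ⟨ab₀, hab₀⟩ := hex
      have hn0 : n < W + W := by
        rw [← hn ab₀.1 ab₀.2 hab₀]; have := hWι ab₀.1; have := hWκ ab₀.2; omega
      refine WtInit.mem_stage_of_homogeneous _ E₀ 0 (i := n) hn0 (hsl c) fun ab hab => ?_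
      simp only [degIK, wt₁, zero_add]
      exact_mod_cast hn ab.1 ab.2 hab
  · calc r ≤ Module.finrank K (testI E₀) := hI
      _ = Module.finrank K (WtInit.stage (degIIK eA eB) (testI E₀) 0 (W + W + W)) :=
          (WtInit.finrank_stage_eq _ _ hlo₂ hhi₂).symm
      _ ≤ _ := Submodule.finrank_mono (stage_testI_le eA eB E₀ hlo hhi 0 _)
  · calc r ≤ Module.finrank K (testK E₀) := hK
      _ = Module.finrank K (WtInit.stage (degIKK eA eB) (testK E₀) 0 (W + W + W)) :=
          (WtInit.finrank_stage_eq _ _ hlo₃ hhi₃).symm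
      _ ≤ _ := Submodule.finrank_mono (stage_testK_le eA eB E₀ hlo hhi 0 _)
  · exact WtInit.projDeg_mem_stage _ E₀ 0 _ hx d

end Graded

/-! ## Tools for bounding the test dimensions from above -/

section Tools

/-- **Triangular families are independent**: if `f_t(c_t) ≠ 0` and `f_s(c_t) = 0` for `s > t`,
the vectors `f_t` are linearly independent. [folklore] -/
theorem linearIndependent_of_triangular {X : Type} {n : ℕ} (f : Fin n → X → K) (c : Fin n → X)
    (hdiag : ∀ t, f t (c t) ≠ 0) (hlow : ∀ s t, t < s → f s (c t) = 0) :
    LinearIndependent K f := by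
  rw [Fintype.linearIndependent_iff]
  intro g hg
  -- `g t = 0` by strong induction on `t`
  have key : ∀ m, ∀ t : Fin n, (t : ℕ) = m → g t = 0 := by
    intro m
    induction m using Nat.strong_induction_on with
    | _ m ih =>
      intro t ht
      have h := congr_fun hg (c t)
      rw [Finset.sum_apply, Pi.zero_apply] at h
      simp only [Pi.smul_apply, smul_eq_mul] at h
      rw [Finset.sum_eq_single t] at h
      · exact (mul_eq_zero.1 h).resolve_right (hdiag t)
      · intro s _ hst
        rcases lt_or_gt_of_ne hst with h1 | h1
        · rw [ih s (by rw [← ht]; exact h1) s rfl, zero_mul]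
        · rw [hlow s t h1, mul_zero]
      · simp
  exact fun t => key t t rfl

/-- If `π` kills `X`, then `dim X + dim π(Y) ≤ dim (X + Y)`. [folklore] -/
theorem finrank_add_finrank_map_le {V W : Type*} [AddCommGroup V] [Module K V] [AddCommGroup W]
    [Module K W] [FiniteDimensional K V] [FiniteDimensional K W] (X Y : Submodule K V)
    (π : V →ₗ[K] W) (hX : ∀ x ∈ X, π x = 0) :
    Module.finrank K X + Module.finrank K (Y.map π) ≤ Module.finrank K ↥(X ⊔ Y) := by
  set A := X ⊔ Y with hA
  let φ : A →ₗ[K] W := π.domRestrict A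
  have hrn := LinearMap.finrank_range_add_finrank_ker φ
  have hrange : LinearMap.range φ = A.map π := LinearMap.range_domRestrict _ _
  have h1 : Module.finrank K (Y.map π) ≤ Module.finrank K (LinearMap.range φ) := by
    rw [hrange]
    exact Submodule.finrank_mono (Submodule.map_mono le_sup_right)
  -- `X` embeds in the kernel
  let ψ : X →ₗ[K] LinearMap.ker φ :=
    { toFun := fun x => ⟨⟨x.1, le_sup_left (b := Y) x.2⟩, by
        change π x.1 = 0
        exact hX x.1 x.2⟩
      map_add' := fun x y => rfl
      map_smul' := fun c x => rfl }
  have hψ : Function.Injective ψ := by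
    intro x y hxy
    apply Subtype.ext
    have h := congr_arg (fun z : LinearMap.ker φ => ((z : A) : V)) hxy
    exact h
  have h2 := LinearMap.finrank_le_finrank_of_injective hψ
  omega

/-- An independent family inside a subspace bounds its dimension from below. [folklore] -/
theorem le_finrank_of_linearIndependent_mem {V : Type*} [AddCommGroup V] [Module K V]
    [FiniteDimensional K V] {n : ℕ} {f : Fin n → V} (hf : LinearIndependent K f)
    (S : Submodule K V) (hS : ∀ t, f t ∈ S) : n ≤ Module.finrank K S := by
  let f' : Fin n → S := fun t => ⟨f t, hS t⟩
  have hf' : LinearIndependent K f' := LinearIndependent.of_comp S.subtype (by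
    have : (S.subtype : S → V) ∘ f' = f := funext fun t => rfl
    rw [this]; exact hf)
  simpa using hf'.fintype_card_le_finrank

/-- `A ⊗ E` in coordinates is `E^ι`: its dimension. [folklore] -/
theorem finrank_slicesI [Fintype ι] [Fintype κ] (E : Submodule K (ι × κ → K)) :
    Module.finrank K (slicesI E) = Fintype.card ι * Module.finrank K E := by
  let e : slicesI E ≃ₗ[K] (ι → E) :=
    { toFun := fun y a₀ => ⟨sliceI a₀ y.1, mem_slicesI.1 y.2 a₀⟩
      map_add' := fun x y => rfl
      map_smul' := fun c x => rfl
      invFun := fun f => ⟨fun s => (f s.1 : ι × κ → K) (s.2.1, s.2.2),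
        mem_slicesI.2 fun a₀ => by
          have : (sliceI a₀ fun s : ι × ι × κ => (f s.1 : ι × κ → K) (s.2.1, s.2.2)) = f a₀ :=
            funext fun ab => rfl
          rw [this]; exact (f a₀).2⟩
      left_inv := fun y => rfl
      right_inv := fun f => rfl }
  rw [LinearEquiv.finrank_eq e, Module.finrank_pi_fintype, Finset.sum_const, Finset.card_univ,
    smul_eq_mul]

/-- `E ⊗ B` in coordinates is `E^κ`: its dimension. [folklore] -/
theorem finrank_slicesK [Fintype ι] [Fintype κ] (E : Submodule K (ι × κ → K)) :
    Module.finrank K (slicesK E) = Fintype.card κ * Module.finrank K E := by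
  let e : slicesK E ≃ₗ[K] (κ → E) :=
    { toFun := fun z b₁ => ⟨sliceK b₁ z.1, mem_slicesK.1 z.2 b₁⟩
      map_add' := fun x y => rfl
      map_smul' := fun c x => rfl
      invFun := fun f => ⟨fun s => (f s.2.2 : ι × κ → K) (s.1, s.2.1),
        mem_slicesK.2 fun b₁ => by
          have : (sliceK b₁ fun s : ι × κ × κ => (f s.2.2 : ι × κ → K) (s.1, s.2.1)) = f b₁ :=
            funext fun ab => rfl
          rw [this]; exact (f b₁).2⟩
      left_inv := fun z => rfl
      right_inv := fun f => rfl }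
  rw [LinearEquiv.finrank_eq e, Module.finrank_pi_fintype, Finset.sum_const, Finset.card_univ,
    smul_eq_mul]

/-- The skew-symmetrisation `y ↦ y − y ∘ swap` in the two `ι` slots; its kernel is `S²A ⊗ B`.
[folklore] -/
def skewIL : (ι × ι × κ → K) →ₗ[K] (ι × ι × κ → K) where
  toFun y s := y s - y (s.2.1, s.1, s.2.2)
  map_add' x y := by funext s; simp only [Pi.add_apply]; ring
  map_smul' c x := by funext s; simp only [Pi.smul_apply, smul_eq_mul, RingHom.id_apply]; ring

/-- The skew-symmetrisation `z ↦ z − z ∘ swap` in the two `κ` slots; its kernel is `A ⊗ S²B`.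
[folklore] -/
def skewKL : (ι × κ × κ → K) →ₗ[K] (ι × κ × κ → K) where
  toFun z s := z s - z (s.1, s.2.2, s.2.1)
  map_add' x y := by funext s; simp only [Pi.add_apply]; ring
  map_smul' c x := by funext s; simp only [Pi.smul_apply, smul_eq_mul, RingHom.id_apply]; ring

/-- Entries of `skewIL`. [folklore] -/
@[simp] theorem skewIL_apply (y : ι × ι × κ → K) (s : ι × ι × κ) :
    skewIL (K := K) y s = y s - y (s.2.1, s.1, s.2.2) := rfl

/-- Entries of `skewKL`. [folklore] -/
@[simp] theorem skewKL_apply (z : ι × κ × κ → K) (s : ι × κ × κ) :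
    skewKL (K := K) z s = z s - z (s.1, s.2.2, s.2.1) := rfl

/-- `ker skewIL = S²A ⊗ B` (`symA`). [folklore] -/
theorem mem_symA_iff_skewIL {y : ι × ι × κ → K} :
    y ∈ symA K (α := ι) (β := κ) ↔ skewIL y = 0 := by
  constructor
  · intro h
    funext s
    rw [skewIL_apply, Pi.zero_apply, sub_eq_zero]
    exact h s.1 s.2.1 s.2.2
  · intro h a₀ a b
    have := congr_fun h (a₀, a, b)
    rw [skewIL_apply, Pi.zero_apply, sub_eq_zero] at this
    exact this

/-- `ker skewKL = A ⊗ S²B` (`symB`). [folklore] -/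
theorem mem_symB_iff_skewKL {z : ι × κ × κ → K} :
    z ∈ symB K (α := ι) (β := κ) ↔ skewKL z = 0 := by
  constructor
  · intro h
    funext s
    rw [skewKL_apply, Pi.zero_apply, sub_eq_zero]
    exact h s.1 s.2.1 s.2.2
  · intro h a b b₁
    have := congr_fun h (a, b, b₁)
    rw [skewKL_apply, Pi.zero_apply, sub_eq_zero] at this
    exact this

/-- **Rank–nullity for the `(210)` test**: `dim testI E + dim skew(A ⊗ E) = dim (A ⊗ E)`.
[folklore] -/
theorem finrank_testI_add [Fintype ι] [Fintype κ] (E : Submodule K (ι × κ → K)) :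
    Module.finrank K (testI E) + Module.finrank K ((slicesI E).map (skewIL (K := K))) =
      Module.finrank K (slicesI E) := by
  set V := slicesI E with hV
  let φ : V →ₗ[K] (ι × ι × κ → K) := skewIL.domRestrict V
  have hrn := LinearMap.finrank_range_add_finrank_ker φ
  have hrange : LinearMap.range φ = V.map skewIL := LinearMap.range_domRestrict _ _
  let ψ : LinearMap.ker φ ≃ₗ[K] testI E :=
    { toFun := fun x => ⟨x.1.1, mem_symA_iff_skewIL.2 x.2, x.1.2⟩
      map_add' := fun x y => rfl
      map_smul' := fun c x => rfl
      invFun := fun y => ⟨⟨y.1, y.2.2⟩, mem_symA_iff_skewIL.1 y.2.1⟩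
      left_inv := fun x => rfl
      right_inv := fun y => rfl }
  rw [hrange, LinearEquiv.finrank_eq ψ] at hrn
  omega

/-- **Rank–nullity for the `(120)` test.** [folklore] -/
theorem finrank_testK_add [Fintype ι] [Fintype κ] (E : Submodule K (ι × κ → K)) :
    Module.finrank K (testK E) + Module.finrank K ((slicesK E).map (skewKL (K := K))) =
      Module.finrank K (slicesK E) := by
  set V := slicesK E with hV
  let φ : V →ₗ[K] (ι × κ × κ → K) := skewKL.domRestrict V
  have hrn := LinearMap.finrank_range_add_finrank_ker φ
  have hrange : LinearMap.range φ = V.map skewKL := LinearMap.range_domRestrict _ _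
  let ψ : LinearMap.ker φ ≃ₗ[K] testK E :=
    { toFun := fun x => ⟨x.1.1, mem_symB_iff_skewKL.2 x.2, x.1.2⟩
      map_add' := fun x y => rfl
      map_smul' := fun c x => rfl
      invFun := fun y => ⟨⟨y.1, y.2.2⟩, mem_symB_iff_skewKL.1 y.2.1⟩
      left_inv := fun x => rfl
      right_inv := fun y => rfl }
  rw [hrange, LinearEquiv.finrank_eq ψ] at hrn
  omega

end Tools

end BorderApolarity

end Literature.Computability.AlgebraicComplexity

end
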